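import Mathlib
import Summits.ValiantsHypothesis.ValiantsHypothesis.Theorems.NewtonTauWeak.Negative.Zonogon
import Summits.ValiantsHypothesis.ValiantsHypothesis.Theorems.NewtonUnitEquationsNewtonTauWeakAutomatonGenDefs
import Summits.ValiantsHypothesis.ValiantsHypothesis.Theorems.NewtonUnitEquationsNewtonTauWeakAutomatonGenAssembly

/-!
# `NewtonUnitEquationsNewtonTauWeakDigitFrame` — THEOREM B in (near-)crux language: every DIGIT FRAME
# (crux `NewtonTauWeak`, stmt-ValiantsHypothesis-5904; line `binomial-normal-form`, registered stubs
# `stub_digitFrameQuasiPoly` and `stub_digitFrameQuasiShape`)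

`stub_digitFrameQuasiPoly`: `k` products of `m` factors `f_{lj} = g_{lj}(x^{2^{lev j}}, y^{2^{lev j}})`
(`MvPolynomial.expand (2 ^ lev j)`), at most `r` factors on each of the `n` levels, digit polynomials `g_{lj}` of
degree `≤ c` in each variable: `vert(Σ_l Π_j f_{lj}) ≤ (rc+1)² · 4 · A^{⌈log₂ n⌉}`, `A = 4D³ + 2D² + 2D + 2`,
`D = (k (rc+1)⁴)²` — uniformly in `k`.  Proof: regroup each product by level
(`Finset.prod_fiberwise_of_maps_to` along `j ↦ lev j`, `map_prod` for the algebra map `expand (2^i)`):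
`Π_j f_{lj} = genProd (G l) n` with the level polynomial `G l i = Π_{lev j = i} g_{lj}`, of degree `≤ r c` in each
variable (`degreeOf_prod_le`, at most `r` factors of partial degree `≤ c`); the sum is `genSum k n 1 G`, and
THEOREM B (`stub_genAssembly`, `…AutomatonGenAssembly.lean`) with `C = r c` is exactly the claim.

`stub_digitFrameQuasiShape`: the same bound in the admissible quasi shape `(k (rc+1) + 2)^{38 ⌈log₂ (n+2)⌉}`
(logarithm on the number of LEVELS only, no `2^{am}` factor).  Arithmetic from the first statement: `k = 0` is the
empty sum (`vert 0 = 0`); for `k ≥ 1` put `u = rc+1`, `X = k u + 2 ≥ 2`: `D ≤ X^{10}`, `A ≤ 10 X^{30} ≤ X^{34}`,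
`4u² ≤ X⁴`, `⌈log₂ n⌉ ≤ ⌈log₂(n+2)⌉ ≥ 1`, so `4u² A^{⌈log₂ n⌉} ≤ X⁴ · X^{34⌈log₂(n+2)⌉} ≤ X^{38 ⌈log₂(n+2)⌉}`.
[folklore: carry automaton + Theorem Q's product step, regrouped by level]
-/

set_option linter.dupNamespace false

noncomputable section

open scoped BigOperators
open MvPolynomial
open Summit.ValiantsHypothesis.ValiantsHypothesis.Theorems.NewtonTauWeak.Negative (vert vert_le_card_support)

namespace Summit.ValiantsHypothesis.ValiantsHypothesis.Theorems.NewtonTauWeakAutomaton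

namespace DigitFrameAux

/-- **Regrouping a digit frame by level.** A product of digit-scaled factors `expand (2 ^ lev j) (f j)` over
`j : Fin m` is the `n`-level digit-scaled product `genProd` of the level polynomials `Π_{lev j = i} f j`
(the level polynomial of a level `i ≥ n` is `1`): `expand (2^i)` is multiplicative (`map_prod`) and the factors are
regrouped along the fibres of `j ↦ lev j` (`Finset.prod_fiberwise_of_maps_to`). [folklore] -/
theorem prod_expand_eq_genProd (m n : ℕ) (lev : Fin m → Fin n) (f : Fin m → MvPolynomial (Fin 2) ℂ) :
    ∏ j, expand (2 ^ (lev j : ℕ)) (f j) =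
      genProd (fun i : ℕ => if h : i < n then ∏ j ∈ Finset.univ.filter (fun j => lev j = ⟨i, h⟩), f j else 1) n := by
  unfold genProd
  rw [← Finset.prod_fiberwise_of_maps_to (s := Finset.univ) (t := Finset.range n) (g := fun j => (lev j : ℕ))
    (fun j _ => Finset.mem_range.mpr (lev j).isLt)]
  refine Finset.prod_congr rfl fun i hi => ?_
  rw [Finset.mem_range] at hi
  dsimp only
  rw [dif_pos hi, map_prod]
  refine Finset.prod_congr ?_ ?_
  · ext j
    simp [Fin.ext_iff]
  · intro j hj
    simp only [Finset.mem_filter, Finset.mem_univ, true_and] at hj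
    rw [hj]

/-- A product of polynomials whose exponents are `≤ c` in both coordinates, over a finset `s`, has all exponents
`≤ |s| · c` in both coordinates (`degreeOf_prod_le`). [folklore] -/
theorem support_prod_le (c : ℕ) {ι : Type*} (s : Finset ι) (f : ι → MvPolynomial (Fin 2) ℂ)
    (hdeg : ∀ j ∈ s, ∀ e ∈ (f j).support, e 0 ≤ c ∧ e 1 ≤ c) :
    ∀ e ∈ (∏ j ∈ s, f j).support, e 0 ≤ s.card * c ∧ e 1 ≤ s.card * c := by
  intro e he
  have key : ∀ v : Fin 2, e v ≤ s.card * c := by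
    intro v
    calc e v ≤ degreeOf v (∏ j ∈ s, f j) := monomial_le_degreeOf v he
      _ ≤ ∑ j ∈ s, degreeOf v (f j) := degreeOf_prod_le v s f
      _ ≤ ∑ j ∈ s, c := Finset.sum_le_sum fun j hj => GenSupportAux.degreeOf_level_le v c (f j) (hdeg j hj)
      _ = s.card * c := by rw [Finset.sum_const, smul_eq_mul]
  exact ⟨key 0, key 1⟩

/-- **The level polynomials of a digit frame have degree `≤ r c` in each variable**: at most `r` factors per level
(`hmult`), each of degree `≤ c` in each variable; the level polynomial `1` of a level `i ≥ n` has degree `0`.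
[folklore] -/
theorem support_level_le (m n r c : ℕ) (lev : Fin m → Fin n)
    (hmult : ∀ i : Fin n, (Finset.univ.filter fun j => lev j = i).card ≤ r)
    (f : Fin m → MvPolynomial (Fin 2) ℂ) (hdeg : ∀ j, ∀ e ∈ (f j).support, e 0 ≤ c ∧ e 1 ≤ c) (i : ℕ) :
    ∀ e ∈ ((if h : i < n then ∏ j ∈ Finset.univ.filter (fun j => lev j = ⟨i, h⟩), f j else 1 :
      MvPolynomial (Fin 2) ℂ)).support, e 0 ≤ r * c ∧ e 1 ≤ r * c := by
  intro e he
  by_cases hi : i < n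
  · rw [dif_pos hi] at he
    have h := support_prod_le c _ f (fun j _ => hdeg j) e he
    have hr := hmult ⟨i, hi⟩
    exact ⟨h.1.trans (Nat.mul_le_mul_right c hr), h.2.trans (Nat.mul_le_mul_right c hr)⟩
  · rw [dif_neg hi] at he
    have key : ∀ v : Fin 2, e v ≤ r * c := fun v =>
      calc e v ≤ degreeOf v (1 : MvPolynomial (Fin 2) ℂ) := monomial_le_degreeOf v he
        _ = 0 := degreeOf_one v
        _ ≤ r * c := Nat.zero_le _
    exact ⟨key 0, key 1⟩

/-- **The arithmetic of the admissible quasi shape.**  For `k, u, L ≥ 1` and `c' ≤ L`, with `D = (k u⁴)²` and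
`A = 4D³ + 2D² + 2D + 2`: `u² · 4 · A^{c'} ≤ (k u + 2)^{38 L}` (put `X = k u + 2 ≥ 2`: `u, k ≤ X`, `D ≤ X^{10}`,
`A ≤ 10 X^{30} ≤ X^{34}`, `4u² ≤ X⁴ ≤ X^{4L}`). -/
theorem arith_shape (k u L c' : ℕ) (hk : 1 ≤ k) (hu1 : 1 ≤ u) (hc1 : c' ≤ L) (hc2 : 1 ≤ L) :
    u * u * (4 * (4 * (k * (u * u * (u * u)) * (k * (u * u * (u * u)))) ^ 3 +
      2 * (k * (u * u * (u * u)) * (k * (u * u * (u * u)))) ^ 2 +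
      2 * (k * (u * u * (u * u)) * (k * (u * u * (u * u)))) + 2) ^ c') ≤ (k * u + 2) ^ (38 * L) := by
  set D : ℕ := k * (u * u * (u * u)) * (k * (u * u * (u * u))) with hD
  set A : ℕ := 4 * D ^ 3 + 2 * D ^ 2 + 2 * D + 2 with hA
  set X : ℕ := k * u + 2 with hX
  have hX2 : 2 ≤ X := Nat.le_add_left 2 (k * u)
  have hX1 : 1 ≤ X := le_trans one_le_two hX2
  have huX : u ≤ X :=
    calc u = 1 * u := (one_mul u).symm
      _ ≤ k * u := Nat.mul_le_mul_right u hk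
      _ ≤ k * u + 2 := Nat.le_add_right _ _
  have hkX : k ≤ X :=
    calc k = k * 1 := (mul_one k).symm
      _ ≤ k * u := Nat.mul_le_mul_left k hu1
      _ ≤ k * u + 2 := Nat.le_add_right _ _
  have hDX : D ≤ X ^ 10 := by
    have h5 : k * (u * u * (u * u)) ≤ X ^ 5 :=
      calc k * (u * u * (u * u)) ≤ X * (X * X * (X * X)) :=
            Nat.mul_le_mul hkX (Nat.mul_le_mul (Nat.mul_le_mul huX huX) (Nat.mul_le_mul huX huX))
        _ = X ^ 5 := by ring
    calc D = k * (u * u * (u * u)) * (k * (u * u * (u * u))) := rfl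
      _ ≤ X ^ 5 * X ^ 5 := Nat.mul_le_mul h5 h5
      _ = X ^ 10 := by rw [← pow_add]
  have hAX : A ≤ X ^ 34 := by
    have h30 : 1 ≤ X ^ 30 := Nat.one_le_pow _ _ hX1
    have hD3 : D ^ 3 ≤ X ^ 30 :=
      calc D ^ 3 ≤ (X ^ 10) ^ 3 := Nat.pow_le_pow_left hDX 3
        _ = X ^ 30 := by rw [← pow_mul]
    have hD2 : D ^ 2 ≤ X ^ 30 :=
      calc D ^ 2 ≤ (X ^ 10) ^ 2 := Nat.pow_le_pow_left hDX 2
        _ = X ^ 20 := by rw [← pow_mul]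
        _ ≤ X ^ 30 := Nat.pow_le_pow_right hX1 (by norm_num)
    have hD1 : D ≤ X ^ 30 := hDX.trans (Nat.pow_le_pow_right hX1 (by norm_num))
    have h10 : 10 ≤ X ^ 4 :=
      calc 10 ≤ 2 ^ 4 := by norm_num
        _ ≤ X ^ 4 := Nat.pow_le_pow_left hX2 4
    calc A = 4 * D ^ 3 + 2 * D ^ 2 + 2 * D + 2 := rfl
      _ ≤ 4 * X ^ 30 + 2 * X ^ 30 + 2 * X ^ 30 + 2 * X ^ 30 := by omega
      _ = 10 * X ^ 30 := by ring
      _ ≤ X ^ 4 * X ^ 30 := Nat.mul_le_mul_right _ h10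
      _ = X ^ 34 := by rw [← pow_add]
  have h4 : u * u * 4 ≤ X ^ 4 :=
    calc u * u * 4 ≤ X * X * (X * X) := Nat.mul_le_mul (Nat.mul_le_mul huX huX) (Nat.mul_le_mul hX2 hX2)
      _ = X ^ 4 := by ring
  have hX34 : 1 ≤ X ^ 34 := Nat.one_le_pow _ _ hX1
  calc u * u * (4 * A ^ c') = u * u * 4 * A ^ c' := by ring
    _ ≤ X ^ 4 * (X ^ 34) ^ L :=
        Nat.mul_le_mul h4 ((Nat.pow_le_pow_left hAX _).trans (Nat.pow_le_pow_right hX34 hc1))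
    _ = X ^ 4 * X ^ (34 * L) := by rw [← pow_mul]
    _ ≤ X ^ (4 * L) * X ^ (34 * L) :=
        Nat.mul_le_mul_right _ (Nat.pow_le_pow_right hX1 (Nat.le_mul_of_pos_right 4 hc2))
    _ = X ^ (38 * L) := by rw [← pow_add]; congr 1; ring

end DigitFrameAux

/-! ## THEOREM B on every digit frame -/

/-- **THEOREM B in (near-)crux language: every DIGIT FRAME, uniformly in `k`.**  For `k` products of `m` factors
`f_{lj} = g_{lj}(x^{2^{lev j}}, y^{2^{lev j}})` (`MvPolynomial.expand (2 ^ lev j) (g l j)`) with at most `r` factors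
on each of the `n` levels and digit polynomials `g l j` of degree `≤ c` in each variable,
`vert(Σ_l Π_j f_{lj}) ≤ (rc+1)² · 4 · A^{⌈log₂ n⌉}`, `A = 4D³ + 2D² + 2D + 2`, `D = (k (rc+1)⁴)²`.
Proof: regroup by level (`DigitFrameAux.prod_expand_eq_genProd`): `Π_j f_{lj} = genProd (G l) n` with
`G l i = Π_{lev j = i} g_{lj}` of degree `≤ r c` in each variable (`DigitFrameAux.support_level_le`), the sum is
`genSum k n 1 G` (`C 1 = 1`), then THEOREM B `stub_genAssembly` with `C = r c`. [folklore] -/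
theorem stub_digitFrameQuasiPoly (k m n r c : ℕ) (lev : Fin m → Fin n)
    (hmult : ∀ i : Fin n, (Finset.univ.filter fun j => lev j = i).card ≤ r)
    (g : Fin k → Fin m → MvPolynomial (Fin 2) ℂ) (hdeg : ∀ l j, ∀ e ∈ (g l j).support, e 0 ≤ c ∧ e 1 ≤ c) :
    vert (∑ l, ∏ j, MvPolynomial.expand (2 ^ (lev j : ℕ)) (g l j)) ≤ (r * c + 1) * (r * c + 1) * (4 *
      (4 * (k * ((r * c + 1) * (r * c + 1) * ((r * c + 1) * (r * c + 1))) *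
            (k * ((r * c + 1) * (r * c + 1) * ((r * c + 1) * (r * c + 1))))) ^ 3 +
        2 * (k * ((r * c + 1) * (r * c + 1) * ((r * c + 1) * (r * c + 1))) *
            (k * ((r * c + 1) * (r * c + 1) * ((r * c + 1) * (r * c + 1))))) ^ 2 +
        2 * (k * ((r * c + 1) * (r * c + 1) * ((r * c + 1) * (r * c + 1))) *
            (k * ((r * c + 1) * (r * c + 1) * ((r * c + 1) * (r * c + 1))))) + 2) ^
      Nat.clog 2 n) := by
  have hsum : (∑ l, ∏ j, MvPolynomial.expand (2 ^ (lev j : ℕ)) (g l j)) =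
      genSum k n (fun _ => (1 : ℂ)) (fun l i => if h : i < n then
        ∏ j ∈ Finset.univ.filter (fun j => lev j = ⟨i, h⟩), g l j else 1) := by
    unfold genSum
    refine Finset.sum_congr rfl fun l _ => ?_
    simp only [C_1, one_mul]
    exact DigitFrameAux.prod_expand_eq_genProd m n lev (g l)
  rw [hsum]
  exact stub_genAssembly k (r * c) n (fun _ => 1) _
    (fun l i => DigitFrameAux.support_level_le m n r c lev hmult (g l) (hdeg l) i)

/-- **The digit-frame bound in the admissible quasi shape.**  Under the hypotheses of `stub_digitFrameQuasiPoly`,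
`vert(Σ_l Π_j f_{lj}) ≤ (k (rc+1) + 2)^{38 ⌈log₂ (n+2)⌉}` — quasi-polynomial with the logarithm on the number of
LEVELS only, no `2^{am}` factor.  Arithmetic from `stub_digitFrameQuasiPoly`: `k = 0` is the empty sum
(`vert 0 = 0` by `vert_le_card_support`); for `k ≥ 1`, with `u = rc+1` and `X = k u + 2 ≥ 2`: `u, k ≤ X`,
`D ≤ X^{10}`, `A ≤ 10 X^{30} ≤ X^{34}`, `4u² ≤ X⁴`, `⌈log₂ n⌉ ≤ ⌈log₂(n+2)⌉ ≥ 1`, hence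
`4u² A^{⌈log₂ n⌉} ≤ X⁴ (X^{34})^{⌈log₂(n+2)⌉} ≤ X^{38 ⌈log₂(n+2)⌉}`. [folklore] -/
theorem stub_digitFrameQuasiShape (k m n r c : ℕ) (lev : Fin m → Fin n)
    (hmult : ∀ i : Fin n, (Finset.univ.filter fun j => lev j = i).card ≤ r)
    (g : Fin k → Fin m → MvPolynomial (Fin 2) ℂ) (hdeg : ∀ l j, ∀ e ∈ (g l j).support, e 0 ≤ c ∧ e 1 ≤ c) :
    vert (∑ l, ∏ j, MvPolynomial.expand (2 ^ (lev j : ℕ)) (g l j)) ≤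
      (k * (r * c + 1) + 2) ^ (38 * Nat.clog 2 (n + 2)) := by
  rcases Nat.eq_zero_or_pos k with hk | hk
  · -- no products: the sum is `0`, which has no vertices
    subst hk
    have h0 : (∑ l : Fin 0, ∏ j, MvPolynomial.expand (2 ^ (lev j : ℕ)) (g l j)) = 0 := Fin.sum_univ_zero _
    rw [h0]
    have h := vert_le_card_support (0 : MvPolynomial (Fin 2) ℂ)
    rw [MvPolynomial.support_zero, Finset.card_empty] at h
    exact h.trans (Nat.zero_le _)
  · exact (stub_digitFrameQuasiPoly k m n r c lev hmult g hdeg).trans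
      (DigitFrameAux.arith_shape k (r * c + 1) (Nat.clog 2 (n + 2)) (Nat.clog 2 n) hk (Nat.le_add_left 1 _)
        (Nat.clog_mono_right 2 (Nat.le_add_right n 2))
        (Nat.clog_pos one_lt_two (Nat.lt_of_lt_of_le one_lt_two (Nat.le_add_left 2 n))))

end Summit.ValiantsHypothesis.ValiantsHypothesis.Theorems.NewtonTauWeakAutomaton

end
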